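import Literature.MathematicalPhysics.QuantumFieldTheory.OSPointDensities
import Literature.Analysis.FunctionSpaces.SchwartzFlatVanishing
import Mathlib.Geometry.Manifold.PartitionOfUnity
import Mathlib.Analysis.SpecialFunctions.JapaneseBracket
import HarnessLib

/-!
# The global representation (4.4): `𝔖_N(F) = ∫ S_N F` for all test functions supported in the ordered region

Topic `Literature/MathematicalPhysics/QuantumFieldTheory`; support file (all proved; the merged
configuration as a definition; no named facts) for the discharge of (A1)
`OS1975_exists_timeContinuation`. Osterwalder–Schrader II (Comm. Math. Phys. 42 (1975)), §IV.2
Thm. 4.1 (4.4): `𝔖_k(f) = ∫ S_k(ξ) f(ξ) dξ` for all `f ∈ 𝒮(ℝ₊^{4k})` — from the *local*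
representation on small balls (`OSPointDensities.IsLocalDensity`): first for compactly supported
test functions by a smooth partition of unity, then for all Schwartz functions supported in the open
region of increasing times, using that such functions vanish to infinite order, with decay, at the
hyperplanes of coinciding times (`SchwartzFlatVanishing`) while the density blows up only
polynomially there ((4.5), any exponent), so that `F ↦ ∫ S F` is continuous in the Schwartz
seminorms on these test functions and the compactly supported cut-offs converge.

* `IsLocalDensity.integral_eq_of_hasCompactSupport` — compact support;
* `mergeCfg`, `norm_le_of_tsupport_subset_incrTimes` — a test function supported in the region
  is bounded by `C · p(F) · minGap(x)^k (1 + ‖x‖)^{-m}`;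
* `IsLocalDensity.integral_eq` — **(4.4) for all test functions supported in the region**, for a
  local density with a bound `‖S x‖ ≤ C (1 + ‖x‖)^{N₀} (1 + (minGap x)⁻¹)^{N₀}`.

## References

* K. Osterwalder, R. Schrader, *Axioms for Euclidean Green's functions II*, Comm. Math. Phys.
  42 (1975) 281–305, §IV.2 Thm. 4.1 (4.4)–(4.5). [OsterwalderSchraderCMP1975]
-/

noncomputable section

open MeasureTheory Set Filter Metric Function
open _root_.Topology
open scoped SchwartzMap Manifold ContDiff

namespace Literature.MathematicalPhysics.QuantumFieldTheory

variable {d : ℕ} [NeZero d]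

open Literature.MathematicalPhysics.QuantumLattice (SchwingerFamily)
open Literature.MathematicalPhysics.QuantumLattice.SchwingerFamily
open Literature.Analysis.Complex Literature.Analysis.FunctionSpaces

/-! ### Compactly supported test functions: partition of unity -/

section Compact

variable {N : ℕ} {𝔖 : SchwingerFamily (EuclideanSpace ℝ (Fin d))} {S : (Fin N → EuclideanSpace ℝ (Fin d)) → ℂ}

/-- A continuous density times a test function supported in the region is continuous and, if the
test function has compact support, integrable. [folklore] -/
theorem IsLocalDensity.integrable_mul (hS : IsLocalDensity 𝔖 N S) (F : 𝓢((Fin N → EuclideanSpace ℝ (Fin d)), ℂ))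
    (hFc : HasCompactSupport (F : (Fin N → EuclideanSpace ℝ (Fin d)) → ℂ))
    (hF : tsupport (F : (Fin N → EuclideanSpace ℝ (Fin d)) → ℂ) ⊆ incrTimes N d) :
    Integrable fun x => S x * F x :=
  (continuous_mul_of_continuousOn_of_tsupport_subset isOpen_incrTimes hS.cont F.continuous hF).integrable_of_hasCompactSupport
    hFc.mul_left

/-- **(4.4) for compactly supported test functions**: `𝔖 N F = ∫ S F` whenever `F` has compact
support in the region of increasing times (smooth partition of unity subordinate to the
representation balls). [cite: OsterwalderSchraderCMP1975, §IV.2 Thm. 4.1 (4.4)] -/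
theorem IsLocalDensity.integral_eq_of_hasCompactSupport (hS : IsLocalDensity 𝔖 N S)
    (F : 𝓢((Fin N → EuclideanSpace ℝ (Fin d)), ℂ)) (hFc : HasCompactSupport (F : (Fin N → EuclideanSpace ℝ (Fin d)) → ℂ))
    (hF : tsupport (F : (Fin N → EuclideanSpace ℝ (Fin d)) → ℂ) ⊆ incrTimes N d) :
    𝔖 N F = ∫ x, S x * F x := by
  classical
  set K := tsupport (F : (Fin N → EuclideanSpace ℝ (Fin d)) → ℂ) with hK
  have hKc : IsCompact K := hFc
  -- representation balls around the points of `K`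
  have hball : ∀ y : K, ∃ r : ℝ, 0 < r ∧ ball (y : Fin N → EuclideanSpace ℝ (Fin d)) r ⊆ incrTimes N d ∧
      ∀ G : 𝓢((Fin N → EuclideanSpace ℝ (Fin d)), ℂ), tsupport (G : (Fin N → EuclideanSpace ℝ (Fin d)) → ℂ) ⊆ ball (y : _) r →
        𝔖 N G = ∫ z, S z * G z := fun y => by
    obtain ⟨r, hr, hb, hrep⟩ := hS.rep y (hF y.2)
    exact ⟨r, hr, hb, hrep⟩
  choose r hr hrU hrep using hball
  have hKU : K ⊆ ⋃ y : K, ball (y : Fin N → EuclideanSpace ℝ (Fin d)) (r y) :=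
    fun z hz => mem_iUnion.2 ⟨⟨z, hz⟩, mem_ball_self (hr ⟨z, hz⟩)⟩
  obtain ⟨t, ht⟩ := hKc.elim_finite_subcover (fun y : K => ball (y : Fin N → EuclideanSpace ℝ (Fin d)) (r y))
    (fun y => isOpen_ball) hKU
  have hKU' : K ⊆ ⋃ y : t, ball ((y : K) : Fin N → EuclideanSpace ℝ (Fin d)) (r y) := by
    intro z hz
    have h := ht hz
    simp only [mem_iUnion] at h ⊢
    obtain ⟨y, hy, hz'⟩ := h
    exact ⟨⟨y, hy⟩, hz'⟩
  -- a smooth partition of unity on `K` subordinate to the finite subcover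
  obtain ⟨ρ, hρ⟩ := SmoothPartitionOfUnity.exists_isSubordinate 𝓘(ℝ, Fin N → EuclideanSpace ℝ (Fin d))
    hKc.isClosed (fun y : t => ball ((y : K) : Fin N → EuclideanSpace ℝ (Fin d)) (r y)) (fun y => isOpen_ball) hKU'
  have hρs : ∀ i : t, ContDiff ℝ ∞ (fun y : Fin N → EuclideanSpace ℝ (Fin d) => ((ρ i y : ℝ) : ℂ)) := fun i =>
    Complex.ofRealCLM.contDiff.comp (contMDiff_iff_contDiff.1 (ρ i).contMDiff)
  have hGs : ∀ i : t, ContDiff ℝ ∞ (fun y => ((ρ i y : ℝ) : ℂ) * F y) := fun i => (hρs i).mul (F.smooth ⊤)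
  have hGc : ∀ i : t, HasCompactSupport (fun y => ((ρ i y : ℝ) : ℂ) * F y) := fun i => hFc.mul_left
  let Fi : t → 𝓢((Fin N → EuclideanSpace ℝ (Fin d)), ℂ) := fun i => (hGc i).toSchwartzMap (hGs i)
  have hFi_apply : ∀ i y, Fi i y = ((ρ i y : ℝ) : ℂ) * F y := fun i y => rfl
  have hsum : ∑ i, Fi i = F := by
    ext y
    simp only [sum_apply, hFi_apply, ← Finset.sum_mul]
    by_cases hy : y ∈ K
    · have h1 : ∑ i, (ρ i y : ℝ) = 1 := by
        have := ρ.sum_eq_one hy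
        rwa [finsum_eq_sum_of_fintype] at this
      rw [← Complex.ofReal_sum, h1, Complex.ofReal_one, one_mul]
    · rw [image_eq_zero_of_notMem_tsupport hy, mul_zero]
  have hFi_supp : ∀ i : t, tsupport (Fi i : (Fin N → EuclideanSpace ℝ (Fin d)) → ℂ) ⊆
      ball (((i : t) : K) : Fin N → EuclideanSpace ℝ (Fin d)) (r i) := by
    intro i
    refine subset_trans ?_ (hρ i)
    refine (tsupport_mul_subset_left (f := fun y => ((ρ i y : ℝ) : ℂ)) (g := (F : _ → ℂ))).trans ?_
    exact closure_mono fun y hy => by simpa [Function.mem_support] using hy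
  have hFi_suppK : ∀ i : t, tsupport (Fi i : (Fin N → EuclideanSpace ℝ (Fin d)) → ℂ) ⊆ incrTimes N d := fun i =>
    (tsupport_mul_subset_right.trans hF)
  have hFi_c : ∀ i : t, HasCompactSupport (Fi i : (Fin N → EuclideanSpace ℝ (Fin d)) → ℂ) := fun i => hGc i
  -- sum up
  calc 𝔖 N F = ∑ i, 𝔖 N (Fi i) := by rw [← hsum, map_sum]
    _ = ∑ i, ∫ x, S x * Fi i x := Finset.sum_congr rfl fun i _ => hrep _ (Fi i) (hFi_supp i)
    _ = ∫ x, ∑ i, S x * Fi i x := (integral_finsetSum _ fun i _ => hS.integrable_mul (Fi i) (hFi_c i) (hFi_suppK i)).symm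
    _ = ∫ x, S x * F x := by
        refine integral_congr_ae (Eventually.of_forall fun x => ?_)
        simp only [← Finset.mul_sum]
        rw [← hsum, sum_apply]

end Compact

/-! ### All test functions supported in the region -/

section General

variable {k : ℕ} {𝔖 : SchwingerFamily (EuclideanSpace ℝ (Fin d))} {S : (Fin (k + 2) → EuclideanSpace ℝ (Fin d)) → ℂ}

/-- **The merged configuration**: the point `i + 1` moved in time onto the point `i`; it lies outside
the region of increasing times, at distance the `i`-th gap from `x`. [folklore] -/
def mergeCfg (x : Fin (k + 2) → EuclideanSpace ℝ (Fin d)) (i : Fin (k + 1)) : Fin (k + 2) → EuclideanSpace ℝ (Fin d) :=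
  update x i.succ (x i.succ + timeVec (x (Fin.castSucc i) 0 - x i.succ 0))

/-- The merged configuration has two equal times, hence does not lie in the region. [folklore] -/
theorem mergeCfg_notMem (x : Fin (k + 2) → EuclideanSpace ℝ (Fin d)) (i : Fin (k + 1)) :
    mergeCfg x i ∉ incrTimes (k + 2) d := by
  intro h
  have hlt := h (Fin.castSucc_lt_succ (i := i))
  have h1 : mergeCfg x i i.succ 0 = x (Fin.castSucc i) 0 := by
    simp [mergeCfg, timeVec]
  have h2 : mergeCfg x i (Fin.castSucc i) 0 = x (Fin.castSucc i) 0 := by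
    rw [mergeCfg, update_of_ne (Fin.castSucc_lt_succ (i := i)).ne]
  simp only [h1, h2, lt_self_iff_false] at hlt

/-- The distance from `x` to the merged configuration is at most the `i`-th gap. [folklore] -/
theorem norm_sub_mergeCfg_le (x : Fin (k + 2) → EuclideanSpace ℝ (Fin d)) (i : Fin (k + 1)) :
    ‖x - mergeCfg x i‖ ≤ |x i.succ 0 - x (Fin.castSucc i) 0| := by
  refine (pi_norm_le_iff_of_nonneg (abs_nonneg _)).2 fun j => ?_
  rw [Pi.sub_apply]
  by_cases hj : j = i.succ
  · subst hj
    rw [mergeCfg, update_self, sub_add_cancel_left, norm_neg,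
      show (timeVec (x (Fin.castSucc i) 0 - x i.succ 0) : EuclideanSpace ℝ (Fin d)) =
        PiLp.single 2 (0 : Fin d) (x (Fin.castSucc i) 0 - x i.succ 0) from rfl, PiLp.norm_single, Real.norm_eq_abs, abs_sub_comm]
  · rw [mergeCfg, update_of_ne hj, sub_self, norm_zero]; exact abs_nonneg _

/-- **Every configuration is at distance at most `|minGap x|` from the complement of the region.** [folklore] -/
theorem exists_notMem_incrTimes_norm_sub_le (x : Fin (k + 2) → EuclideanSpace ℝ (Fin d)) :
    ∃ y, y ∉ incrTimes (k + 2) d ∧ ‖x - y‖ ≤ |minGap x| := by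
  obtain ⟨i₀, -, hi₀⟩ := Finset.exists_mem_eq_inf' Finset.univ_nonempty
    (fun i : Fin (k + 1) => x i.succ 0 - x (Fin.castSucc i) 0)
  refine ⟨mergeCfg x i₀, mergeCfg_notMem x i₀, (norm_sub_mergeCfg_le x i₀).trans (le_of_eq ?_)⟩
  rw [minGap, hi₀]

/-- **A test function supported in the region is flat at the hyperplanes of coinciding times**:
`(1 + ‖x‖)^m ‖G x‖ ≤ 4^m · p_{m,n}(G) · |minGap x|^n`. [folklore] -/
theorem pow_mul_norm_le_of_tsupport_subset (G : 𝓢((Fin (k + 2) → EuclideanSpace ℝ (Fin d)), ℂ))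
    (hG : tsupport (G : (Fin (k + 2) → EuclideanSpace ℝ (Fin d)) → ℂ) ⊆ incrTimes (k + 2) d) (n m : ℕ)
    (x : Fin (k + 2) → EuclideanSpace ℝ (Fin d)) :
    (1 + ‖x‖) ^ m * ‖G x‖ ≤
      (4 : ℝ) ^ m * (Finset.Iic (m, n)).sup (fun p => SchwartzMap.seminorm ℝ p.1 p.2) G * |minGap x| ^ n := by
  obtain ⟨y, hy, hxy⟩ := exists_notMem_incrTimes_norm_sub_le x
  have hy' : y ∉ tsupport (G : (Fin (k + 2) → EuclideanSpace ℝ (Fin d)) → ℂ) := fun h => hy (hG h)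
  refine (SchwartzMap.pow_mul_norm_le_seminorm_mul_pow_dist G n m x y hy').trans ?_
  have h0 : 0 ≤ (4 : ℝ) ^ m * (Finset.Iic (m, n)).sup (fun p => SchwartzMap.seminorm ℝ p.1 p.2) G := by
    have := apply_nonneg ((Finset.Iic (m, n)).sup (fun p => SchwartzMap.seminorm ℝ p.1 p.2)) G; positivity
  exact mul_le_mul_of_nonneg_left (pow_le_pow_left₀ (norm_nonneg _) hxy n) h0

/-- **The key estimate**: for a density bounded by `C (1 + ‖x‖)^{N₀} (1 + (minGap x)⁻¹)^{N₀}` on the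
region and a test function `G` supported in the region,
`‖S x · G x‖ ≤ C 4^{2N₀+M} 2^{N₀} · p(G) · ((1 + ‖x‖)^M)⁻¹` everywhere. [cite: OsterwalderSchraderCMP1975, §IV.2 Thm. 4.1 (4.4)–(4.5)] -/
theorem norm_density_mul_le {C : ℝ} {N₀ : ℕ} (hC : 0 ≤ C)
    (hb : ∀ x ∈ incrTimes (k + 2) d, ‖S x‖ ≤ C * (1 + ‖x‖) ^ N₀ * (1 + (minGap x)⁻¹) ^ N₀) (M : ℕ)
    (G : 𝓢((Fin (k + 2) → EuclideanSpace ℝ (Fin d)), ℂ))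
    (hG : tsupport (G : (Fin (k + 2) → EuclideanSpace ℝ (Fin d)) → ℂ) ⊆ incrTimes (k + 2) d)
    (x : Fin (k + 2) → EuclideanSpace ℝ (Fin d)) :
    ‖S x * G x‖ ≤ C * (4 : ℝ) ^ (2 * N₀ + M) * (2 : ℝ) ^ N₀ *
      (Finset.Iic (2 * N₀ + M, N₀)).sup (fun p => SchwartzMap.seminorm ℝ p.1 p.2) G * ((1 + ‖x‖) ^ M)⁻¹ := by
  set Sem : ℝ := (Finset.Iic (2 * N₀ + M, N₀)).sup (fun p => SchwartzMap.seminorm ℝ p.1 p.2) G with hSem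
  have hSem0 : 0 ≤ Sem := apply_nonneg _ _
  have hx1 : 0 < 1 + ‖x‖ := by positivity
  by_cases hx : x ∈ incrTimes (k + 2) d
  swap
  · -- outside the region the test function vanishes
    have hGx : G x = 0 := image_eq_zero_of_notMem_tsupport fun h => hx (hG h)
    rw [hGx, mul_zero, norm_zero]; positivity
  have hg : 0 < minGap x := minGap_pos (by rw [orderedRegion_eq_incrTimes]; exact hx)
  have hflat := pow_mul_norm_le_of_tsupport_subset G hG N₀ (2 * N₀ + M) x
  rw [abs_of_pos hg, ← hSem] at hflat
  -- `‖G x‖ ≤ 4^{m} Sem g^{N₀} / (1 + ‖x‖)^{m}`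
  have hGx : ‖G x‖ ≤ (4 : ℝ) ^ (2 * N₀ + M) * Sem * minGap x ^ N₀ / (1 + ‖x‖) ^ (2 * N₀ + M) := by
    rw [le_div_iff₀ (by positivity), mul_comm]; exact hflat
  -- `(1 + g⁻¹) g = g + 1 ≤ 2 (1 + ‖x‖)`
  have hgg : (1 + (minGap x)⁻¹) * minGap x ≤ 2 * (1 + ‖x‖) := by
    rw [add_mul, one_mul, inv_mul_cancel₀ hg.ne']
    have := minGap_le_two_mul_norm x
    linarith [norm_nonneg x]
  have hprod : (1 + (minGap x)⁻¹) ^ N₀ * minGap x ^ N₀ ≤ (2 : ℝ) ^ N₀ * (1 + ‖x‖) ^ N₀ := by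
    rw [← mul_pow, ← mul_pow]
    exact pow_le_pow_left₀ (by positivity) hgg N₀
  rw [norm_mul]
  calc ‖S x‖ * ‖G x‖ ≤ (C * (1 + ‖x‖) ^ N₀ * (1 + (minGap x)⁻¹) ^ N₀) *
        ((4 : ℝ) ^ (2 * N₀ + M) * Sem * minGap x ^ N₀ / (1 + ‖x‖) ^ (2 * N₀ + M)) :=
        mul_le_mul (hb x hx) hGx (norm_nonneg _) (by positivity)
    _ = C * (4 : ℝ) ^ (2 * N₀ + M) * Sem * ((1 + ‖x‖) ^ N₀ * ((1 + (minGap x)⁻¹) ^ N₀ * minGap x ^ N₀)) /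
          (1 + ‖x‖) ^ (2 * N₀ + M) := by ring
    _ ≤ C * (4 : ℝ) ^ (2 * N₀ + M) * Sem * ((1 + ‖x‖) ^ N₀ * ((2 : ℝ) ^ N₀ * (1 + ‖x‖) ^ N₀)) /
          (1 + ‖x‖) ^ (2 * N₀ + M) := by
        gcongr
    _ = C * (4 : ℝ) ^ (2 * N₀ + M) * (2 : ℝ) ^ N₀ * Sem * ((1 + ‖x‖) ^ M)⁻¹ := by
        rw [show (1 + ‖x‖) ^ (2 * N₀ + M) = ((1 + ‖x‖) ^ N₀ * (1 + ‖x‖) ^ N₀) * (1 + ‖x‖) ^ M by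
          rw [pow_add, two_mul, pow_add]]
        field_simp

/-- The finite sup of Schwartz seminorms tends to zero along a sequence tending to a limit, applied to
the differences. [folklore] -/
theorem tendsto_sup_seminorm_sub {V : Type*} [NormedAddCommGroup V] [NormedSpace ℝ V] (s : Finset (ℕ × ℕ))
    {u : ℕ → 𝓢(V, ℂ)} {F : 𝓢(V, ℂ)} (hlim : Tendsto u atTop (𝓝 F)) :
    Tendsto (fun j => s.sup (fun p : ℕ × ℕ => SchwartzMap.seminorm ℝ p.1 p.2) (u j - F)) atTop (𝓝 0) := by
  have h0 : Tendsto (fun j => u j - F) atTop (𝓝 0) := by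
    have := hlim.sub_const F; rwa [sub_self] at this
  have hp := schwartz_withSeminorms ℝ V ℂ
  have hq : ∀ q : ℕ × ℕ, Tendsto (fun j => SchwartzMap.seminorm ℝ q.1 q.2 (u j - F)) atTop (𝓝 0) := fun q => by
    have hc : Continuous (fun G : 𝓢(V, ℂ) => SchwartzMap.seminorm ℝ q.1 q.2 G) := hp.continuous_seminorm q
    have h := (hc.tendsto 0).comp h0
    rwa [map_zero] at h
  have hsum : Tendsto (fun j => ∑ q ∈ s, SchwartzMap.seminorm ℝ q.1 q.2 (u j - F)) atTop (𝓝 0) := by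
    have h := tendsto_finsetSum s fun q _ => hq q
    rwa [Finset.sum_const_zero] at h
  refine squeeze_zero (fun j => apply_nonneg _ _) (fun j => ?_) hsum
  exact Seminorm.finset_sup_apply_le (Finset.sum_nonneg fun q _ => apply_nonneg _ _)
    fun q hq' => Finset.single_le_sum (f := fun q : ℕ × ℕ => SchwartzMap.seminorm ℝ q.1 q.2 (u j - F))
      (fun q _ => apply_nonneg _ _) hq'

/-- **Osterwalder–Schrader II, (4.4), for all test functions supported in the region of increasing
times**: a continuous local density of `𝔖 (k+2)` obeying a temperedness bound
`‖S x‖ ≤ C (1 + ‖x‖)^{N₀} (1 + (minGap x)⁻¹)^{N₀}` represents `𝔖 (k+2)` on *every* Schwartz function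
`F` with `tsupport F` in the region: `S · F` is integrable and `𝔖 (k+2) F = ∫ S F`. [cite: OsterwalderSchraderCMP1975, §IV.2 Thm. 4.1 (4.4)] -/
theorem IsLocalDensity.integral_eq (hS : IsLocalDensity 𝔖 (k + 2) S)
    (hb : ∃ C : ℝ, ∃ N₀ : ℕ, ∀ x ∈ incrTimes (k + 2) d, ‖S x‖ ≤ C * (1 + ‖x‖) ^ N₀ * (1 + (minGap x)⁻¹) ^ N₀)
    (F : 𝓢((Fin (k + 2) → EuclideanSpace ℝ (Fin d)), ℂ))
    (hF : tsupport (F : (Fin (k + 2) → EuclideanSpace ℝ (Fin d)) → ℂ) ⊆ incrTimes (k + 2) d) :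
    Integrable (fun x => S x * F x) ∧ 𝔖 (k + 2) F = ∫ x, S x * F x := by
  obtain ⟨C', N₀, hb'⟩ := hb
  -- a nonnegative constant
  set C : ℝ := max C' 0 with hCdef
  have hC : 0 ≤ C := le_max_right _ _
  have hbC : ∀ x ∈ incrTimes (k + 2) d, ‖S x‖ ≤ C * (1 + ‖x‖) ^ N₀ * (1 + (minGap x)⁻¹) ^ N₀ := fun x hx =>
    (hb' x hx).trans (by
      have hg : 0 < minGap x := minGap_pos (by rw [orderedRegion_eq_incrTimes]; exact hx)
      have : 0 ≤ (1 + ‖x‖) ^ N₀ * (1 + (minGap x)⁻¹) ^ N₀ := by positivity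
      rw [mul_assoc, mul_assoc]
      exact mul_le_mul_of_nonneg_right (le_max_left _ _) this)
  -- the integrable weight
  set M : ℕ := Module.finrank ℝ (Fin (k + 2) → EuclideanSpace ℝ (Fin d)) + 1 with hM
  have hw : Integrable fun x : Fin (k + 2) → EuclideanSpace ℝ (Fin d) => ((1 + ‖x‖) ^ M)⁻¹ := by
    have h := integrable_one_add_norm (E := Fin (k + 2) → EuclideanSpace ℝ (Fin d)) (μ := volume) (r := (M : ℝ))
      (by rw [hM]; push_cast; linarith)
    refine h.congr (Eventually.of_forall fun x => ?_)
    show (1 + ‖x‖) ^ (-(M : ℝ)) = ((1 + ‖x‖) ^ M)⁻¹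
    rw [Real.rpow_neg (by positivity), Real.rpow_natCast]
  -- the seminorm-continuity estimate for every `G` supported in the region
  set Kc : ℝ := C * (4 : ℝ) ^ (2 * N₀ + M) * (2 : ℝ) ^ N₀ with hKc
  set sem : 𝓢((Fin (k + 2) → EuclideanSpace ℝ (Fin d)), ℂ) → ℝ := fun G =>
    (Finset.Iic (2 * N₀ + M, N₀)).sup (fun p => SchwartzMap.seminorm ℝ p.1 p.2) G with hsem
  have hest : ∀ G : 𝓢((Fin (k + 2) → EuclideanSpace ℝ (Fin d)), ℂ),
      tsupport (G : (Fin (k + 2) → EuclideanSpace ℝ (Fin d)) → ℂ) ⊆ incrTimes (k + 2) d →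
        ∀ x, ‖S x * G x‖ ≤ Kc * sem G * ((1 + ‖x‖) ^ M)⁻¹ := fun G hG x =>
    norm_density_mul_le hC hbC M G hG x
  have hint : ∀ G : 𝓢((Fin (k + 2) → EuclideanSpace ℝ (Fin d)), ℂ),
      tsupport (G : (Fin (k + 2) → EuclideanSpace ℝ (Fin d)) → ℂ) ⊆ incrTimes (k + 2) d →
        Integrable fun x => S x * G x := fun G hG =>
    Integrable.mono' ((hw.const_mul (Kc * sem G)))
      (continuous_mul_of_continuousOn_of_tsupport_subset isOpen_incrTimes hS.cont G.continuous hG).aestronglyMeasurable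
      (Eventually.of_forall fun x => hest G hG x)
  have hbound : ∀ G : 𝓢((Fin (k + 2) → EuclideanSpace ℝ (Fin d)), ℂ),
      tsupport (G : (Fin (k + 2) → EuclideanSpace ℝ (Fin d)) → ℂ) ⊆ incrTimes (k + 2) d →
        ‖∫ x, S x * G x‖ ≤ Kc * sem G * ∫ x : Fin (k + 2) → EuclideanSpace ℝ (Fin d), ((1 + ‖x‖) ^ M)⁻¹ := fun G hG => by
    calc ‖∫ x, S x * G x‖ ≤ ∫ x, Kc * sem G * ((1 + ‖x‖) ^ M)⁻¹ :=
          norm_integral_le_of_norm_le (hw.const_mul _) (Eventually.of_forall fun x => hest G hG x)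
      _ = Kc * sem G * ∫ x : Fin (k + 2) → EuclideanSpace ℝ (Fin d), ((1 + ‖x‖) ^ M)⁻¹ := integral_const_mul _ _
  refine ⟨hint F hF, ?_⟩
  -- the compactly supported cut-offs
  obtain ⟨u, hu, hlim⟩ := QuantumLattice.exists_tsupport_subset_inter_closedBall_tendsto F
  have huF : ∀ j, tsupport (u j : (Fin (k + 2) → EuclideanSpace ℝ (Fin d)) → ℂ) ⊆ incrTimes (k + 2) d := fun j =>
    (hu j).trans (inter_subset_left.trans hF)
  have huc : ∀ j, HasCompactSupport (u j : (Fin (k + 2) → EuclideanSpace ℝ (Fin d)) → ℂ) := fun j =>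
    IsCompact.of_isClosed_subset (isCompact_closedBall _ _) (isClosed_tsupport _) ((hu j).trans inter_subset_right)
  have h1 : ∀ j, 𝔖 (k + 2) (u j) = ∫ x, S x * u j x := fun j => hS.integral_eq_of_hasCompactSupport (u j) (huc j) (huF j)
  have h2 : Tendsto (fun j => 𝔖 (k + 2) (u j)) atTop (𝓝 (𝔖 (k + 2) F)) := ((𝔖 (k + 2)).continuous.tendsto F).comp hlim
  have h3 : Tendsto (fun j => ∫ x, S x * u j x) atTop (𝓝 (∫ x, S x * F x)) := by
    rw [tendsto_iff_norm_sub_tendsto_zero]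
    set I : ℝ := ∫ x : Fin (k + 2) → EuclideanSpace ℝ (Fin d), ((1 + ‖x‖) ^ M)⁻¹ with hI
    have hsubF : ∀ j, tsupport ((u j - F : 𝓢((Fin (k + 2) → EuclideanSpace ℝ (Fin d)), ℂ)) :
        (Fin (k + 2) → EuclideanSpace ℝ (Fin d)) → ℂ) ⊆ incrTimes (k + 2) d := by
      intro j
      have hcoe : ((u j - F : 𝓢((Fin (k + 2) → EuclideanSpace ℝ (Fin d)), ℂ)) :
          (Fin (k + 2) → EuclideanSpace ℝ (Fin d)) → ℂ) = (u j : _ → ℂ) - (F : _ → ℂ) := rfl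
      rw [hcoe]
      refine (closure_mono (Function.support_sub _ _)).trans ?_
      rw [closure_union]
      exact union_subset (huF j) hF
    have hdiff : ∀ j, ‖(∫ x, S x * u j x) - ∫ x, S x * F x‖ ≤ Kc * sem (u j - F) * I := by
      intro j
      have heq : (∫ x, S x * u j x) - ∫ x, S x * F x = ∫ x, S x * (u j - F) x := by
        rw [← integral_sub (hint (u j) (huF j)) (hint F hF)]
        refine integral_congr_ae (Eventually.of_forall fun x => ?_)
        simp only [sub_apply, mul_sub]
      rw [heq]
      exact hbound (u j - F) (hsubF j)
    have hto : Tendsto (fun j => Kc * sem (u j - F) * I) atTop (𝓝 0) := by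
      have h := ((tendsto_sup_seminorm_sub (Finset.Iic (2 * N₀ + M, N₀)) hlim).const_mul Kc).mul_const I
      simpa [hsem] using h
    exact squeeze_zero (fun j => norm_nonneg _) hdiff hto
  exact tendsto_nhds_unique h2 (h3.congr fun j => (h1 j).symm)

end General

end Literature.MathematicalPhysics.QuantumFieldTheory
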